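import Mathlib.Geometry.Manifold.PartitionOfUnity
import Literature.Topology.FourManifolds.CollarTheorem
import HarnessLib

/-!
# The collar neighbourhood theorem for arbitrary (non-compact) manifolds with boundary

Topic `Literature/Topology/FourManifolds` (fact seat
`provefact-Literature.Topology.FourManifolds.exists_halfDisc_face_eq`).  Everything here is proved; no named facts.

* `Literature.Topology.FourManifolds.BoundaryData.nonempty_collar_holds` — **discharge of the named fact
  `Literature.Topology.FourManifolds.BoundaryData.nonempty_collar`** of `Gluing.lean`: the boundary of every smooth
  `(n+2)`-manifold with boundary `M` (Hausdorff, second countable, model `𝓡∂ (n + 2)`; compact or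
  not) admits a collar `∂M × [0, 1] ↪ M` in the sense of `Literature.Topology.FourManifolds.BoundaryData.Collar`, for every
  boundary datum (Hirsch, *Differential Topology* (1976), Ch. 4 §6 Thm. 6.1, with the proof by
  differential equations of Ch. 6 §2 Thm. 2.1; M. Brown, Ann. Math. 75 (1962) for the topological
  version; Milnor, *Lectures on the h-cobordism theorem* (1965), §1 and proof of Thm. 3.4; Lee,
  *Introduction to Smooth Manifolds* (2013), Thms. 9.24–9.25).  The compact case is the tree's
  `Literature.Topology.FourManifolds.BoundaryData.nonempty_collar_of_compactSpace` (`CollarTheorem.lean`), which this theorem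
  supersedes.

The compact proof flows out from the boundary along a vector field `ξ` with `ξ(f) = 1` on a
*sublevel set* `{f ≤ δ}` of a boundary-defining function `f` (`Literature.Topology.FourManifolds.FlowoutInput`,
`BoundaryFlowout.lean`), for a uniform time `a > 0` over a *finite* cover by chart boxes; both the
constant `δ` (`Literature.Topology.FourManifolds.exists_pos_forall_mfderiv_ne_zero`) and the cover
(`FlowoutInput.nonempty_cover`) exist by compactness only.  Here (Hirsch's proof of Thm. 6.2.1: an
inward field `X` on a neighbourhood of `∂M`, its flow `η` on a neighbourhood `W ⊆ ∂M × [0, ∞)` of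
`∂M × 0`, an embedding `h : ∂M × [0, ∞) → W` fixing `∂M × 0`, `F = η ∘ h`; Lee's Thm. 9.24 with a
flow time `δ : ∂M → ℝ₊` depending on the point) the normalisation `ξ(f) = 1` is only required on an
open neighbourhood `N` of `∂M`, and the flow time is a smooth positive function.

* §1 `locallyCompactSpace_of_chartedSpace_euclideanHalfSpace`,
  `sigmaCompactSpace_of_chartedSpace_euclideanHalfSpace` (Mathlib: finite-dimensional manifolds
  with boundary are locally compact, hence σ-compact when second countable).
* §2 `CollarFlowData k M` — smooth `f ≥ 0` vanishing exactly on `∂M`, smooth `ξ`, open `N ⊇ ∂M`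
  with `ξ(f) = 1` on `N`; `nonempty_collarFlowData` on every Hausdorff σ-compact `M` (Milnor's
  boundary-defining function, Lemma 2.6, `Literature.Topology.FourManifolds.exists_contMDiff_eq_one_on_boundary`; the open set
  of its regular points, `Literature.Topology.FourManifolds.isOpen_setOf_mfderiv_ne_zero`; a closed neighbourhood of `∂M` inside
  it by normality; the partition-of-unity field
  `Literature.Topology.FourManifolds.exists_contMDiffSection_mlineDeriv_eq_one_on` of `RegularSlabField.lean`);
  `FlowoutInput.toCollarFlowData` exhibits the compact-case input as the special case `N = {f < δ}`.
* §3–§7 `CollarFlowData.ChartBox y` / `nonempty_chartBox` at every `y ∈ N` — the chart boxes of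
  `BoundaryFlowout.lean` (§3–§5 and §7 there, stated for `FlowoutInput` and for the boxes of a
  finite cover), with the sublevel condition `levelIn < δ` replaced by membership of the analysis
  ball in `N`: field and level function read in a chart, flow curves `curve z t` (`t ∈ [-f z, ε]`),
  `f (curve z t) = f z + t`, the flow curves as integral curves of `ξ`, joint smoothness of
  `(z, t) ↦ curve z t` on `dom × [0, ε]` and of `z ↦ curve z (-f z)` on `dom ∩ {f < ε}` for a single
  box, forward/backward uniqueness.  (These generalise, and could replace, their `FlowoutInput`
  counterparts; the proofs are the same.)
* §8 *Admissible heights.*  `Adm z r`: some chosen box contains `z`, has flow time `> r`, and its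
  flow curve through `z` stays in the domain of the box during `[0, r]`.  By joint continuity of
  the flow of one box, near every point of `N` one `r > 0` is admissible for all nearby points
  (`exists_nhds_adm`); admissible heights form a convex set; hence Mathlib's
  `exists_contMDiffMap_forall_mem_convex_of_local_const` (smooth partitions of unity) gives a
  smooth `α : M → ℝ`, `α > 0`, admissible along `∂M` (`HeightFn`, `nonempty_heightFn`) — Lee's `δ`.
* §9 *The tube and the retraction.*  On the open tube `⋃ (dom C ∩ {f < ε_C})` over all chosen
  boxes the backward flow `ret z = curve z (-f z) ∈ ∂M` is independent of the box (backward
  uniqueness, Hausdorff `M`) and smooth; `ret (curve z₀ s) = z₀` and `curve (ret z) (f z) = z`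
  (uniqueness again) — Milnor's `h⁻¹(y) = (ψ_y(0), f(y))`.
* §10 *The open collar.*  `toFun x t = curve (incl x) (t α(incl x) / 2)` (`t ∈ [0, 2)`, in the
  box chosen at `incl x`), `proj = incl⁻¹ ∘ ret`, `height z = 2 f z / α (ret z)`,
  `region = {z ∈ tube | f z < α (ret z)}` constitute `Literature.Topology.FourManifolds.BoundaryData.OpenCollarData`
  (`CollarCriterion.lean`), whose chart bookkeeping yields the collar (`HeightFn.openCollarData`,
  `CollarFlowData.nonempty_collar`); an empty boundary has the vacuous collar
  `BoundaryData.collarOfIsEmpty` (`CollarTheorem.lean`).  §11 assembles `nonempty_collar_holds`.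

## References

* M. W. Hirsch, *Differential Topology*, GTM 33 (1976), Ch. 4 §6 Thm. 6.1 (p. 113, collaring
  theorem), Ch. 6 §2 Thm. 2.1 (p. 152, proof by differential equations). [Hirsch1976]
* J. Milnor, *Lectures on the h-cobordism theorem*, Princeton (1965), Lemma 2.6, §1 and proof of
  Thm. 3.4. [MilnorHCobordism1965]
* J. M. Lee, *Introduction to Smooth Manifolds*, 2nd ed., GTM 218 (2013), Thm. 9.24 (boundary
  flowout), Thm. 9.25 (collar neighbourhood theorem). [LeeSmoothManifolds2013]
-/

open scoped Manifold ContDiff Topology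
open Set Function Metric

noncomputable section

namespace Literature.Topology.FourManifolds

universe u

/-! ### §1 Topology of finite-dimensional manifolds with boundary -/

section TopologyOfM

/-- A manifold with boundary modelled on the closed half space `EuclideanHalfSpace (k + 1)` is
locally compact (Mathlib's `Manifold.locallyCompact_of_finiteDimensional`). [folklore] -/
theorem locallyCompactSpace_of_chartedSpace_euclideanHalfSpace (k : ℕ) (M : Type u) [TopologicalSpace M]
    [ChartedSpace (EuclideanHalfSpace (k + 1)) M] : LocallyCompactSpace M :=
  Manifold.locallyCompact_of_finiteDimensional (M := M) (𝓡∂ (k + 1))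

/-- A second countable manifold with boundary modelled on `EuclideanHalfSpace (k + 1)` is
σ-compact. [folklore] -/
theorem sigmaCompactSpace_of_chartedSpace_euclideanHalfSpace (k : ℕ) (M : Type u) [TopologicalSpace M]
    [ChartedSpace (EuclideanHalfSpace (k + 1)) M] [SecondCountableTopology M] : SigmaCompactSpace M := by
  haveI : LocallyCompactSpace M := locallyCompactSpace_of_chartedSpace_euclideanHalfSpace k M
  infer_instance

end TopologyOfM

/-! ### §2 The analytic input: `f` boundary-defining, `ξ(f) = 1` on an open `N ⊇ ∂M` -/

section Input

variable (k : ℕ) (M : Type u) [TopologicalSpace M] [ChartedSpace (EuclideanHalfSpace (k + 1)) M]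
  [IsManifold (𝓡∂ (k + 1)) ∞ M]

/-- **Collar flow data** on a manifold with boundary `M` (model `𝓡∂ (k + 1)`): a smooth function
`f ≥ 0` vanishing exactly on `∂M`, a smooth vector field `ξ`, and an open set `N ⊇ ∂M` with
`ξ(f) = 1` on `N` (Milnor, *Lectures on the h-cobordism theorem* (1965), proof of Thm. 3.4,
normalised field near the boundary; Lee (2013), proof of Thm. 9.24).  The compact-case structure
`Literature.Topology.FourManifolds.FlowoutInput` is the special case `N = {f ≤ δ}`; on non-compact `M` only an open
neighbourhood is available (`nonempty_collarFlowData`). [cite: MilnorHCobordism1965, proof of Thm. 3.4] -/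
structure CollarFlowData where
  /-- The boundary-defining function. -/
  f : M → ℝ
  /-- The vector field. -/
  ξ : (z : M) → TangentSpace (𝓡∂ (k + 1)) z
  /-- The open neighbourhood of the boundary where `ξ(f) = 1`. -/
  N : Set M
  isOpen_N : IsOpen N
  boundary_subset_N : (𝓡∂ (k + 1)).boundary M ⊆ N
  f_smooth : ContMDiff (𝓡∂ (k + 1)) 𝓘(ℝ, ℝ) ∞ f
  f_nonneg : ∀ z, 0 ≤ f z
  f_eq_zero_iff : ∀ z, f z = 0 ↔ z ∈ (𝓡∂ (k + 1)).boundary M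
  ξ_smooth : ContMDiff (𝓡∂ (k + 1)) ((𝓡∂ (k + 1)).prod 𝓘(ℝ, EuclideanSpace ℝ (Fin (k + 1)))) ∞
    (fun z => Bundle.TotalSpace.mk' (EuclideanSpace ℝ (Fin (k + 1))) z (ξ z))
  mlineDeriv_f_ξ : ∀ z ∈ N, mlineDeriv (𝓡∂ (k + 1)) f z (ξ z) = 1

variable {k M}

/-- **Collar flow data exist on every Hausdorff σ-compact manifold with boundary.**  Milnor's
boundary-defining function (Lemma 2.6: `Literature.Topology.FourManifolds.exists_contMDiff_eq_one_on_boundary`, `f₁ = 1` and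
`df₁ ≠ 0` on `∂M`, `f₁ < 1` inside; put `f = 1 - f₁`) is regular on the open set
`V = {df ≠ 0} ⊇ ∂M` (`Literature.Topology.FourManifolds.isOpen_setOf_mfderiv_ne_zero`); `∂M = {f = 0}` is closed and `M` is
normal (locally compact, σ-compact, Hausdorff), so some open `N ⊇ ∂M` has `closure N ⊆ V`, and
`Literature.Topology.FourManifolds.exists_contMDiffSection_mlineDeriv_eq_one_on` (`RegularSlabField.lean`, partition of unity)
provides `ξ` with `ξ(f) = 1` on `closure N`. [cite: MilnorHCobordism1965, Lemma 2.6 and proof of Thm. 3.4] -/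
theorem nonempty_collarFlowData [T2Space M] [SigmaCompactSpace M] : Nonempty (CollarFlowData k M) := by
  classical
  obtain ⟨f₁, hf₁, hbd, hint⟩ := exists_contMDiff_eq_one_on_boundary (n := k) (M := M)
  set f : M → ℝ := fun z => 1 - f₁ z with hf
  have hfs : ContMDiff (𝓡∂ (k + 1)) 𝓘(ℝ, ℝ) ∞ f :=
    ((contDiff_const (c := (1 : ℝ))).sub contDiff_id).contMDiff.comp hf₁
  have hfb : ∀ z, f z = 0 ↔ z ∈ (𝓡∂ (k + 1)).boundary M := by
    intro z
    constructor
    · intro hz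
      by_contra hzb
      have hzi : (𝓡∂ (k + 1)).IsInteriorPoint z :=
        ((𝓡∂ (k + 1)).isInteriorPoint_or_isBoundaryPoint z).resolve_right hzb
      have h := hint z hzi
      simp only [hf] at hz
      linarith
    · intro hz
      simp only [hf, (hbd z hz).1, sub_self]
  have hf0 : ∀ z, 0 ≤ f z := by
    intro z
    rcases (𝓡∂ (k + 1)).isInteriorPoint_or_isBoundaryPoint z with hzi | hzb
    · have h := hint z hzi
      simp only [hf]; linarith
    · simp only [hf, (hbd z hzb).1, sub_self, le_refl]
  have hreg : ∀ z, f z = 0 → mfderiv (𝓡∂ (k + 1)) 𝓘(ℝ, ℝ) f z ≠ 0 := by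
    intro z hz hcrit
    have hzb := (hfb z).1 hz
    have hfz : HasMFDerivAt (𝓡∂ (k + 1)) 𝓘(ℝ, ℝ) f z 0 :=
      hcrit ▸ (hfs.mdifferentiableAt (by simp)).hasMFDerivAt
    have h1 := (hasMFDerivAt_const (I := 𝓡∂ (k + 1)) (I' := 𝓘(ℝ, ℝ)) (1 : ℝ) z).sub hfz
    have heq : ((fun _ : M => (1 : ℝ)) - f) = f₁ := by
      funext x; simp [hf]
    rw [heq] at h1
    have h2 : mfderiv (𝓡∂ (k + 1)) 𝓘(ℝ, ℝ) f₁ z = 0 := by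
      rw [h1.mfderiv]; exact sub_self _
    exact (hbd z hzb).2 h2
  -- the open set of regular points and an open neighbourhood of `∂M` with closure inside it
  set V : Set M := {z | mfderiv (𝓡∂ (k + 1)) 𝓘(ℝ, ℝ) f z ≠ 0} with hV
  have hVo : IsOpen V := isOpen_setOf_mfderiv_ne_zero hfs
  have hbV : (𝓡∂ (k + 1)).boundary M ⊆ V := fun z hz => hreg z ((hfb z).2 hz)
  have hbc : IsClosed ((𝓡∂ (k + 1)).boundary M) := by
    have heq : (𝓡∂ (k + 1)).boundary M = f ⁻¹' {0} := by
      ext z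
      rw [mem_preimage, mem_singleton_iff]
      exact (hfb z).symm
    rw [heq]
    exact isClosed_singleton.preimage hfs.continuous
  haveI : LocallyCompactSpace M := locallyCompactSpace_of_chartedSpace_euclideanHalfSpace k M
  obtain ⟨O, hOo, hbO, hOV⟩ := normal_exists_closure_subset hbc hVo hbV
  obtain ⟨ξ, hξ⟩ := exists_contMDiffSection_mlineDeriv_eq_one_on (I := 𝓡∂ (k + 1)) hfs
    (C := closure O) isClosed_closure (fun z hz => hOV hz)
  exact ⟨⟨f, ξ, O, hOo, hbO, hfs, hf0, hfb, ξ.contMDiff, fun z hz => hξ z (subset_closure hz)⟩⟩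

end Input

/-- **The compact-case input is a special case**: flow-out input `(f, ξ, δ)` with `ξ(f) = 1` on
`{f ≤ δ}` (`Literature.Topology.FourManifolds.FlowoutInput`, `BoundaryFlowout.lean`) gives collar flow data with `N = {f < δ}`.
[cite: MilnorHCobordism1965, proof of Thm. 3.4] -/
def FlowoutInput.toCollarFlowData {k : ℕ} {M : Type u} [TopologicalSpace M]
    [ChartedSpace (EuclideanHalfSpace (k + 1)) M] [IsManifold (𝓡∂ (k + 1)) ∞ M]
    (D : FlowoutInput k M) : CollarFlowData k M where
  f := D.f
  ξ := D.ξ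
  N := {z | D.f z < D.δ}
  isOpen_N := isOpen_lt D.f_smooth.continuous continuous_const
  boundary_subset_N z hz := by
    show D.f z < D.δ
    rw [(D.f_eq_zero_iff z).2 hz]
    exact D.δ_pos
  f_smooth := D.f_smooth
  f_nonneg := D.f_nonneg
  f_eq_zero_iff := D.f_eq_zero_iff
  ξ_smooth := D.ξ_smooth
  mlineDeriv_f_ξ z hz := D.mlineDeriv_f_ξ z (le_of_lt hz)

/-- The open set of the collar flow data of a flow-out input is `{f < δ}`. [folklore] -/
@[simp] theorem FlowoutInput.toCollarFlowData_N {k : ℕ} {M : Type u} [TopologicalSpace M]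
    [ChartedSpace (EuclideanHalfSpace (k + 1)) M] [IsManifold (𝓡∂ (k + 1)) ∞ M]
    (D : FlowoutInput k M) : D.toCollarFlowData.N = {z | D.f z < D.δ} := rfl

namespace CollarFlowData

variable {k : ℕ} {M : Type u} [TopologicalSpace M] [ChartedSpace (EuclideanHalfSpace (k + 1)) M]
  [IsManifold (𝓡∂ (k + 1)) ∞ M] (D : CollarFlowData k M)

/-! ### §3 The field and the level function read in a chart -/

/-- The vector field read in the extended chart at `y`: the tree's `Literature.Topology.FourManifolds.vectorFieldInChart`
(`ProductCobordismFlow.lean`; Mathlib's convention for integral curves, `tangentCoordChange`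
from the chart at the point to the chart at `y`). [folklore] -/
abbrev fieldIn (y : M) : EuclideanSpace ℝ (Fin (k + 1)) → EuclideanSpace ℝ (Fin (k + 1)) :=
  vectorFieldInChart (𝓡∂ (k + 1)) D.ξ y

/-- The level function `f` read in the extended chart at `y`. [folklore] -/
def levelIn (y : M) (q : EuclideanSpace ℝ (Fin (k + 1))) : ℝ := D.f ((extChartAt (𝓡∂ (k + 1)) y).symm q)

/-- The vector field read in a chart is `C^∞` on the chart target (within): the tree's
`Literature.Topology.FourManifolds.contDiffOn_vectorFieldInChart`. [folklore] -/
theorem contDiffOn_fieldIn (y : M) :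
    ContDiffOn ℝ ∞ (D.fieldIn y) (extChartAt (𝓡∂ (k + 1)) y).target :=
  contDiffOn_vectorFieldInChart D.ξ_smooth y

/-- The level function read in a chart is `C^∞` on the chart target (within). [folklore] -/
theorem contDiffOn_levelIn (y : M) :
    ContDiffOn ℝ ∞ (D.levelIn y) (extChartAt (𝓡∂ (k + 1)) y).target :=
  (D.f_smooth.comp_contMDiffOn (contMDiffOn_extChartAt_symm (I := 𝓡∂ (k + 1)) y)).contDiffOn

/-- `d(levelIn)(fieldIn) = 1` (derivative within `range I`) at chart points over `N`:
`ξ(f) = 1` read in the chart at `y` (`Literature.Topology.FourManifolds.mfderiv_tangentCoordChange_apply`). [folklore] -/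
theorem fderivWithin_levelIn_fieldIn {y : M} {q : EuclideanSpace ℝ (Fin (k + 1))}
    (hq : q ∈ (extChartAt (𝓡∂ (k + 1)) y).target) (hN : (extChartAt (𝓡∂ (k + 1)) y).symm q ∈ D.N) :
    fderivWithin ℝ (D.levelIn y) (range (𝓡∂ (k + 1))) q (D.fieldIn y q) = 1 := by
  set z := (extChartAt (𝓡∂ (k + 1)) y).symm q with hz
  have hzs : z ∈ (chartAt (EuclideanHalfSpace (k + 1)) y).source := by
    rw [← extChartAt_source (I := 𝓡∂ (k + 1))]
    exact (extChartAt _ y).map_target hq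
  have hqz : extChartAt (𝓡∂ (k + 1)) y z = q := (extChartAt _ y).right_inv hq
  have h := mfderiv_eq_fderivWithin_comp_tangentCoordChange hzs
    (D.f_smooth.mdifferentiableAt (by simp))
  have h2 := DFunLike.congr_fun h (D.ξ z)
  have h1 := D.mlineDeriv_f_ξ z hN
  rw [mlineDeriv_def, h2] at h1
  rw [hqz] at h1
  exact h1

/-- On the chart target, `levelIn y q = 0` iff `q` lies on the boundary hyperplane
(`f = 0 ↔ ∂M`, invariance of the boundary). [folklore] -/
theorem levelIn_eq_zero_iff {y : M} {q : EuclideanSpace ℝ (Fin (k + 1))}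
    (hq : q ∈ (extChartAt (𝓡∂ (k + 1)) y).target) : D.levelIn y q = 0 ↔ halfSpaceCoord k q = 0 := by
  set z := (extChartAt (𝓡∂ (k + 1)) y).symm q with hz
  have hzs : z ∈ (chartAt (EuclideanHalfSpace (k + 1)) y).source := by
    rw [← extChartAt_source (I := 𝓡∂ (k + 1))]
    exact (extChartAt _ y).map_target hq
  have hqz : extChartAt (𝓡∂ (k + 1)) y z = q := (extChartAt _ y).right_inv hq
  rw [levelIn, D.f_eq_zero_iff, BoundaryManifold.mem_boundary_iff_of_mem_atlas (chart_mem_atlas _ y) hzs,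
    halfSpaceCoord_apply, ← hqz]
  rfl

/-- The level function read in a chart is nonnegative. [folklore] -/
theorem levelIn_nonneg (y : M) (q : EuclideanSpace ℝ (Fin (k + 1))) : 0 ≤ D.levelIn y q :=
  D.f_nonneg _

/-- `levelIn y (chart z) = f z` on the chart source. [folklore] -/
theorem levelIn_apply {y z : M} (hz : z ∈ (extChartAt (𝓡∂ (k + 1)) y).source) :
    D.levelIn y (extChartAt (𝓡∂ (k + 1)) y z) = D.f z := by
  simp only [levelIn, (extChartAt _ y).left_inv hz]

/-- `f` vanishes on the image of a boundary inclusion. [folklore] -/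
theorem f_incl (b : BoundaryData (𝓡∂ (k + 1)) M (𝓡 k)) (x : b.carrier) : D.f (b.incl x) = 0 :=
  (D.f_eq_zero_iff _).2 (b.incl_mem_boundary x)

/-! ### §4 Flow boxes in the charts -/

/-- A **chart box** at `y`: a radius `R` such that the trace of `B(extChartAt y y, R)` on the
half-space lies in the chart target and is mapped into `N` by the inverse chart, together with a
flow box of the field read in the chart (`Literature.Analysis.ODE.FlowBox` for the retraction
`modelRetraction`; it records `0 < r < R' < R`).  This is `Literature.Topology.FourManifolds.FlowoutInput.ChartBox` with the
sublevel condition `levelIn < δ` replaced by `N`. [folklore] -/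
structure ChartBox (y : M) where
  /-- The radius of the analysis ball. -/
  R : ℝ
  subset_target : Literature.Analysis.ODE.halfSpace (halfSpaceCoord k) ∩ ball (extChartAt (𝓡∂ (k + 1)) y y) R ⊆
    (extChartAt (𝓡∂ (k + 1)) y).target
  symm_mem : ∀ q ∈ Literature.Analysis.ODE.halfSpace (halfSpaceCoord k) ∩ ball (extChartAt (𝓡∂ (k + 1)) y y) R,
    (extChartAt (𝓡∂ (k + 1)) y).symm q ∈ D.N
  /-- The flow box. -/
  box : Literature.Analysis.ODE.FlowBox (modelRetraction k) (D.fieldIn y) (extChartAt (𝓡∂ (k + 1)) y y) R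

/-- **Chart boxes exist at every point of `N`**: the chart target and the preimage of `N` under
the inverse chart are neighbourhoods of the chart point within the half-space, and
`Literature.Analysis.ODE.nonempty_flowBox` applies to the field read in the chart (which is `C^∞`
within the chart target). [folklore] -/
theorem nonempty_chartBox {y : M} (hy : y ∈ D.N) : Nonempty (D.ChartBox y) := by
  set p := extChartAt (𝓡∂ (k + 1)) y y with hp
  have hpS : p ∈ Literature.Analysis.ODE.halfSpace (halfSpaceCoord k) := FlowoutInput.extChartAt_mem_halfSpace y y
  -- the chart target and the preimage of `N` near `p` within the half-space
  have h1 : (extChartAt (𝓡∂ (k + 1)) y).target ∈ 𝓝[range (𝓡∂ (k + 1))] p :=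
    extChartAt_target_mem_nhdsWithin y
  have h2 : {q | (extChartAt (𝓡∂ (k + 1)) y).symm q ∈ D.N} ∈
      𝓝[(extChartAt (𝓡∂ (k + 1)) y).target] p := by
    have hc : ContinuousWithinAt (extChartAt (𝓡∂ (k + 1)) y).symm (extChartAt (𝓡∂ (k + 1)) y).target p :=
      (continuousOn_extChartAt_symm y) p (mem_extChartAt_target y)
    show (extChartAt (𝓡∂ (k + 1)) y).symm ⁻¹' D.N ∈ _
    apply hc.preimage_mem_nhdsWithin
    apply D.isOpen_N.mem_nhds
    show (extChartAt (𝓡∂ (k + 1)) y).symm p ∈ D.N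
    simp only [hp, extChartAt_to_inv]
    exact hy
  have h2' : {q | (extChartAt (𝓡∂ (k + 1)) y).symm q ∈ D.N} ∈ 𝓝[range (𝓡∂ (k + 1))] p := by
    rw [nhdsWithin_restrict'' (range (𝓡∂ (k + 1))) h1,
      inter_eq_right.2 (extChartAt_target_subset_range y)]
    exact h2
  obtain ⟨R, hR, hRsub⟩ := Metric.mem_nhdsWithin_iff.1 (Filter.inter_mem h1 h2')
  have hsub : Literature.Analysis.ODE.halfSpace (halfSpaceCoord k) ∩ ball p R ⊆
      (extChartAt (𝓡∂ (k + 1)) y).target ∩ {q | (extChartAt (𝓡∂ (k + 1)) y).symm q ∈ D.N} := by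
    rw [halfSpace_halfSpaceCoord, inter_comm]; exact hRsub
  have hV : ContDiffOn ℝ 1 (D.fieldIn y) (Literature.Analysis.ODE.halfSpace (halfSpaceCoord k) ∩ ball p R) :=
    ((D.contDiffOn_fieldIn y).mono fun q hq => (hsub hq).1).of_le (by norm_cast)
  obtain ⟨B⟩ := Literature.Analysis.ODE.nonempty_flowBox (isHalfSpaceRetraction_modelRetraction k) hpS hR hV
  exact ⟨⟨R, fun q hq => (hsub hq).1, fun q hq => (hsub hq).2, B⟩⟩

namespace ChartBox

variable {D} {y : M} (C : D.ChartBox y)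

/-- The trace of the analysis ball on the half-space. [folklore] -/
theorem subset_range : Literature.Analysis.ODE.halfSpace (halfSpaceCoord k) ∩ ball (extChartAt (𝓡∂ (k + 1)) y y) C.R ⊆
    range (𝓡∂ (k + 1)) := fun _ hq => extChartAt_target_subset_range _ (C.subset_target hq)

/-- The field is `C^∞` within the trace of the analysis ball. [folklore] -/
theorem contDiffOn_fieldIn :
    ContDiffOn ℝ ∞ (D.fieldIn y) (Literature.Analysis.ODE.halfSpace (halfSpaceCoord k) ∩ ball (extChartAt (𝓡∂ (k + 1)) y y) C.R) :=
  (D.contDiffOn_fieldIn y).mono C.subset_target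

/-- The level function is `C^∞` within the trace of the analysis ball. [folklore] -/
theorem contDiffOn_levelIn :
    ContDiffOn ℝ ∞ (D.levelIn y) (Literature.Analysis.ODE.halfSpace (halfSpaceCoord k) ∩ ball (extChartAt (𝓡∂ (k + 1)) y y) C.R) :=
  (D.contDiffOn_levelIn y).mono C.subset_target

/-- The level function is differentiable within the trace of the analysis ball. [folklore] -/
theorem differentiableOn_levelIn :
    DifferentiableOn ℝ (D.levelIn y) (Literature.Analysis.ODE.halfSpace (halfSpaceCoord k) ∩ ball (extChartAt (𝓡∂ (k + 1)) y y) C.R) :=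
  C.contDiffOn_levelIn.differentiableOn (by simp)

/-- `d(levelIn)(fieldIn) = 1` within the trace of the analysis ball. [folklore] -/
theorem fderivWithin_levelIn :
    ∀ q ∈ Literature.Analysis.ODE.halfSpace (halfSpaceCoord k) ∩ ball (extChartAt (𝓡∂ (k + 1)) y y) C.R,
      fderivWithin ℝ (D.levelIn y) (Literature.Analysis.ODE.halfSpace (halfSpaceCoord k) ∩ ball (extChartAt (𝓡∂ (k + 1)) y y) C.R)
        q (D.fieldIn y q) = 1 := by
  intro q hq
  rw [fderivWithin_inter (isOpen_ball.mem_nhds hq.2), halfSpace_halfSpaceCoord]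
  exact D.fderivWithin_levelIn_fieldIn (C.subset_target hq) (C.symm_mem q hq)

/-- `levelIn` vanishes on the boundary hyperplane (within the analysis ball). [folklore] -/
theorem levelIn_eq_zero :
    ∀ q ∈ Literature.Analysis.ODE.halfSpace (halfSpaceCoord k) ∩ ball (extChartAt (𝓡∂ (k + 1)) y y) C.R,
      halfSpaceCoord k q = 0 → D.levelIn y q = 0 :=
  fun _ hq h => (D.levelIn_eq_zero_iff (C.subset_target hq)).2 h

/-- `levelIn ≥ 0` (within the analysis ball). [folklore] -/
theorem levelIn_nonneg :
    ∀ q ∈ Literature.Analysis.ODE.halfSpace (halfSpaceCoord k) ∩ ball (extChartAt (𝓡∂ (k + 1)) y y) C.R,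
      0 ≤ D.levelIn y q := fun q' _ => D.levelIn_nonneg y q'

/-- **The field read in the chart points inward along the boundary hyperplane**
(`Literature.Analysis.ODE.pos_apply_of_fderivWithin_apply_eq_one`). [folklore] -/
theorem inward :
    ∀ q ∈ Literature.Analysis.ODE.halfSpace (halfSpaceCoord k) ∩ ball (extChartAt (𝓡∂ (k + 1)) y y) C.R,
      halfSpaceCoord k q = 0 → 0 < halfSpaceCoord k (D.fieldIn y q) := fun _ hq h =>
  Literature.Analysis.ODE.pos_apply_of_fderivWithin_apply_eq_one
    (g' := fderivWithin ℝ (D.levelIn y)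
      (Literature.Analysis.ODE.halfSpace (halfSpaceCoord k) ∩ ball (extChartAt (𝓡∂ (k + 1)) y y) C.R))
    (fun q hq => (C.differentiableOn_levelIn q hq).hasFDerivWithinAt) C.levelIn_nonneg
    C.levelIn_eq_zero C.fderivWithin_levelIn hq h

/-- The domain of the chart box in `M`: the points of the chart source whose chart value lies
in the ball of initial conditions. [folklore] -/
def dom : Set M :=
  (extChartAt (𝓡∂ (k + 1)) y).source ∩ extChartAt (𝓡∂ (k + 1)) y ⁻¹' ball (extChartAt (𝓡∂ (k + 1)) y y) C.box.r

/-- The domain of a chart box is open. [folklore] -/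
theorem isOpen_dom : IsOpen C.dom :=
  (continuousOn_extChartAt y).isOpen_inter_preimage (isOpen_extChartAt_source y) isOpen_ball

/-- The centre belongs to the domain of its chart box. [folklore] -/
theorem mem_dom : y ∈ C.dom := ⟨mem_extChartAt_source y, mem_ball_self C.box.r_pos⟩

/-- Chart values of points of the domain are admissible initial conditions. [folklore] -/
theorem apply_mem {z : M} (hz : z ∈ C.dom) :
    extChartAt (𝓡∂ (k + 1)) y z ∈ Literature.Analysis.ODE.halfSpace (halfSpaceCoord k) ∩ closedBall (extChartAt (𝓡∂ (k + 1)) y y) C.box.r := by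
  exact ⟨FlowoutInput.extChartAt_mem_halfSpace y z, ball_subset_closedBall hz.2⟩

/-- Chart values of points of the domain, open-ball version. [folklore] -/
theorem apply_mem_ball {z : M} (hz : z ∈ C.dom) :
    extChartAt (𝓡∂ (k + 1)) y z ∈ Literature.Analysis.ODE.halfSpace (halfSpaceCoord k) ∩ ball (extChartAt (𝓡∂ (k + 1)) y y) C.box.r :=
  ⟨(C.apply_mem hz).1, hz.2⟩

/-- **The flow curve** in `M` through `z`: the chart-box flow of the chart value of `z`, mapped
back by the chart. [folklore] -/
def curve (z : M) (t : ℝ) : M :=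
  (extChartAt (𝓡∂ (k + 1)) y).symm (C.box.flow (extChartAt (𝓡∂ (k + 1)) y z) t)

/-- The flow curve starts at `z`. [folklore] -/
theorem curve_zero {z : M} (hz : z ∈ C.dom) : C.curve z 0 = z := by
  simp only [curve, C.box.flow_zero _ (C.apply_mem hz).2, (extChartAt _ y).left_inv hz.1]

/-- For `t ∈ [-f z, ε]` (with `f z ≤ ε`) the chart flow stays in the trace of the analysis ball
on the half-space (forward invariance and backward invariance up to the boundary,
`HalfSpaceFlow.lean`). [folklore] -/
theorem flow_mem {z : M} (hz : z ∈ C.dom) (hfz : D.f z ≤ C.box.ε) {t : ℝ}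
    (ht : t ∈ Icc (-D.f z) C.box.ε) :
    C.box.flow (extChartAt (𝓡∂ (k + 1)) y z) t ∈
      Literature.Analysis.ODE.halfSpace (halfSpaceCoord k) ∩ ball (extChartAt (𝓡∂ (k + 1)) y y) C.R := by
  have h := C.box.flow_mem_of_level (isHalfSpaceRetraction_modelRetraction k) (FlowoutInput.extChartAt_mem_halfSpace y y) C.inward
    C.differentiableOn_levelIn C.fderivWithin_levelIn C.levelIn_eq_zero (C.apply_mem hz)
    (by rwa [D.levelIn_apply hz.1]) (t := t) (by rwa [D.levelIn_apply hz.1])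
  exact h

/-- The flow curve stays in the chart source. [folklore] -/
theorem curve_mem_source {z : M} (hz : z ∈ C.dom) (hfz : D.f z ≤ C.box.ε) {t : ℝ}
    (ht : t ∈ Icc (-D.f z) C.box.ε) : C.curve z t ∈ (extChartAt (𝓡∂ (k + 1)) y).source :=
  (extChartAt _ y).map_target (C.subset_target (C.flow_mem hz hfz ht))

/-- **Level identity along the flow curve**: `f (curve z t) = f z + t`. [folklore] -/
theorem f_curve {z : M} (hz : z ∈ C.dom) (hfz : D.f z ≤ C.box.ε) {t : ℝ}
    (ht : t ∈ Icc (-D.f z) C.box.ε) : D.f (C.curve z t) = D.f z + t := by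
  have h := C.box.level_eq_add_of_level (isHalfSpaceRetraction_modelRetraction k) (FlowoutInput.extChartAt_mem_halfSpace y y)
    C.inward C.differentiableOn_levelIn C.fderivWithin_levelIn C.levelIn_eq_zero C.levelIn_nonneg
    (C.apply_mem hz) (by rwa [D.levelIn_apply hz.1]) (t := t) (by rwa [D.levelIn_apply hz.1])
  rw [D.levelIn_apply hz.1] at h
  exact h

/-- The chart flow solves `u' = fieldIn u` within `[-f z, ε]`. [folklore] -/
theorem hasDerivWithinAt_flow {z : M} (hz : z ∈ C.dom) (hfz : D.f z ≤ C.box.ε) {t : ℝ}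
    (ht : t ∈ Icc (-D.f z) C.box.ε) :
    HasDerivWithinAt (C.box.flow (extChartAt (𝓡∂ (k + 1)) y z))
      (D.fieldIn y (C.box.flow (extChartAt (𝓡∂ (k + 1)) y z) t)) (Icc (-D.f z) C.box.ε) t := by
  have hsub : Icc (-D.f z) C.box.ε ⊆ Icc (-C.box.ε) C.box.ε := Icc_subset_Icc (by linarith) le_rfl
  have h := (C.box.hasDerivWithinAt _ (C.apply_mem hz).2 t (hsub ht)).mono hsub
  rwa [(isHalfSpaceRetraction_modelRetraction k).eq_self _ (C.flow_mem hz hfz ht).1] at h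

end ChartBox

/-! ### §5 The flow curves are integral curves; uniqueness tools -/

namespace ChartBox

variable {D} {y : M} (C : D.ChartBox y)

/-- **The flow curves are integral curves of `ξ`** on `[-f z, ε]`. [folklore] -/
theorem isMIntegralCurveOn_curve {z : M} (hz : z ∈ C.dom) (hfz : D.f z ≤ C.box.ε) :
    IsMIntegralCurveOn (C.curve z) D.ξ (Icc (-D.f z) C.box.ε) :=
  isMIntegralCurveOn_symm_comp y (fun _ ht => C.subset_target (C.flow_mem hz hfz ht))
    fun _ ht => C.hasDerivWithinAt_flow hz hfz ht

end ChartBox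

/-- The vector field is `C¹` (as needed by the uniqueness theorems). [folklore] -/
theorem ξ_contMDiff_one :
    ContMDiff (𝓡∂ (k + 1)) (𝓡∂ (k + 1)).tangent 1 (fun z => (⟨z, D.ξ z⟩ : TangentBundle (𝓡∂ (k + 1)) M)) :=
  D.ξ_smooth.of_le (by norm_cast)

namespace ChartBox

variable {D} {y : M} (C : D.ChartBox y)


/-! ### §6 Smoothness of the flow curves and of the retraction, in a fixed box -/

/-- **The flow curves of a box are jointly smooth** on `dom × [0, ε]` (within):
`extChartAt⁻¹ ∘ flow ∘ (extChartAt × id)`, with `flow` smooth within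
`({x₀ ≥ 0} ∩ B) × [0, ε]` by `Literature.Analysis.ODE.FlowBox.contDiffOn_flow`. [folklore] -/
theorem contMDiffOn_curve :
    ContMDiffOn ((𝓡∂ (k + 1)).prod 𝓘(ℝ, ℝ)) (𝓡∂ (k + 1)) ∞
      (fun p : M × ℝ => C.curve p.1 p.2) (C.dom ×ˢ Icc 0 C.box.ε) := by
  have h1 : ContMDiffOn ((𝓡∂ (k + 1)).prod 𝓘(ℝ, ℝ)) 𝓘(ℝ, EuclideanSpace ℝ (Fin (k + 1)) × ℝ) ∞
      (fun p : M × ℝ => (extChartAt (𝓡∂ (k + 1)) y p.1, p.2))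
      ((extChartAt (𝓡∂ (k + 1)) y).source ×ˢ (univ : Set ℝ)) := by
    refine ContMDiffOn.prodMk_space ?_ contMDiffOn_snd
    exact (contMDiffOn_extChartAt (n := ∞) (x := y)).comp contMDiffOn_fst fun p hp => by
      rw [← extChartAt_source (I := 𝓡∂ (k + 1))]; exact hp.1
  have h2 : ContMDiffOn 𝓘(ℝ, EuclideanSpace ℝ (Fin (k + 1)) × ℝ) 𝓘(ℝ, EuclideanSpace ℝ (Fin (k + 1))) ∞
      (fun q : EuclideanSpace ℝ (Fin (k + 1)) × ℝ => C.box.flow q.1 q.2)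
      ((Literature.Analysis.ODE.halfSpace (halfSpaceCoord k) ∩ ball (extChartAt (𝓡∂ (k + 1)) y y) C.box.r) ×ˢ Icc 0 C.box.ε) :=
    (C.box.contDiffOn_flow (isHalfSpaceRetraction_modelRetraction k) (FlowoutInput.extChartAt_mem_halfSpace y y) C.inward
      (n := ⊤) (by simp) C.contDiffOn_fieldIn).contMDiffOn
  have h3 := contMDiffOn_extChartAt_symm (I := 𝓡∂ (k + 1)) (n := ∞) y
  have h12 := h2.comp (h1.mono (prod_mono (fun z hz => hz.1) (subset_univ _))) fun p hp =>
    ⟨C.apply_mem_ball hp.1, hp.2⟩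
  refine (h3.comp h12 fun p hp => ?_).congr fun p hp => rfl
  exact C.subset_target (C.box.flow_mem (isHalfSpaceRetraction_modelRetraction k) (FlowoutInput.extChartAt_mem_halfSpace y y)
    C.inward (C.apply_mem hp.1) hp.2)

/-- **The retraction is smooth in a fixed box**: `z ↦ curve z (-f z)` is `C^∞` on
`dom ∩ {f < ε}` (`Literature.Analysis.ODE.FlowBox.contDiffOn_flow_neg_level`). [folklore] -/
theorem contMDiffOn_curve_neg :
    ContMDiffOn (𝓡∂ (k + 1)) (𝓡∂ (k + 1)) ∞ (fun z => C.curve z (-D.f z))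
      (C.dom ∩ {z | D.f z < C.box.ε}) := by
  have h1 : ContMDiffOn (𝓡∂ (k + 1)) 𝓘(ℝ, EuclideanSpace ℝ (Fin (k + 1))) ∞
      (extChartAt (𝓡∂ (k + 1)) y) (extChartAt (𝓡∂ (k + 1)) y).source := by
    have h := contMDiffOn_extChartAt (I := 𝓡∂ (k + 1)) (n := ∞) (x := y)
    rwa [← extChartAt_source (I := 𝓡∂ (k + 1))] at h
  have h2 : ContMDiffOn 𝓘(ℝ, EuclideanSpace ℝ (Fin (k + 1))) 𝓘(ℝ, EuclideanSpace ℝ (Fin (k + 1))) ∞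
      (fun q => C.box.flow q (-D.levelIn y q))
      ((Literature.Analysis.ODE.halfSpace (halfSpaceCoord k) ∩ ball (extChartAt (𝓡∂ (k + 1)) y y) C.box.r) ∩
        {q | D.levelIn y q < C.box.ε}) :=
    (C.box.contDiffOn_flow_neg_level (isHalfSpaceRetraction_modelRetraction k) (FlowoutInput.extChartAt_mem_halfSpace y y)
      C.inward (n := ⊤) (by simp) C.contDiffOn_fieldIn C.contDiffOn_levelIn C.fderivWithin_levelIn
      C.levelIn_eq_zero C.levelIn_nonneg).contMDiffOn
  have h3 := contMDiffOn_extChartAt_symm (I := 𝓡∂ (k + 1)) (n := ∞) y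
  have h1' : ContMDiffOn (𝓡∂ (k + 1)) 𝓘(ℝ, EuclideanSpace ℝ (Fin (k + 1))) ∞
      (extChartAt (𝓡∂ (k + 1)) y) (C.dom ∩ {z | D.f z < C.box.ε}) := h1.mono fun z hz => hz.1.1
  have h12 := h2.comp h1' fun z hz =>
    ⟨C.apply_mem_ball hz.1, by show D.levelIn y _ < _; rw [D.levelIn_apply hz.1.1]; exact hz.2⟩
  refine (h3.comp h12 fun z hz => ?_).congr fun z hz => ?_
  · exact C.subset_target (C.box.flow_neg_level_mem (isHalfSpaceRetraction_modelRetraction k)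
      (FlowoutInput.extChartAt_mem_halfSpace y y) C.inward C.differentiableOn_levelIn C.fderivWithin_levelIn C.levelIn_eq_zero
      C.levelIn_nonneg (C.apply_mem hz.1) (by rw [D.levelIn_apply hz.1.1]; exact hz.2.le)).1
  · simp only [ChartBox.curve, comp_apply, D.levelIn_apply hz.1.1]

end ChartBox

/-! ### §7 Uniqueness of integral curves (Hausdorff `M`) -/

variable [T2Space M]

/-- **Forward uniqueness**: two integral curves of `ξ` on `[a, b]` which agree at `a` agree on
`[a, b]` (`IntegralCurveBoundary.lean`). [folklore] -/
theorem eqOn_of_eq_left {γ γ' : ℝ → M} {a b : ℝ} (hγ : IsMIntegralCurveOn γ D.ξ (Icc a b))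
    (hγ' : IsMIntegralCurveOn γ' D.ξ (Icc a b)) (h : γ a = γ' a) : EqOn γ γ' (Icc a b) :=
  isMIntegralCurveOn_Icc_eqOn_of_contMDiff_left D.ξ_contMDiff_one hγ hγ' h

/-- **Backward uniqueness**: two integral curves of `ξ` on `[a, b]` which agree at `b` agree on
`[a, b]` (the tree's `IsMIntegralCurveOn.eqOn_Icc_of_eq_right`, `ProductCobordismFlow.lean`:
time reversal). [folklore] -/
theorem eqOn_of_eq_right {γ γ' : ℝ → M} {a b : ℝ} (hγ : IsMIntegralCurveOn γ D.ξ (Icc a b))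
    (hγ' : IsMIntegralCurveOn γ' D.ξ (Icc a b)) (h : γ b = γ' b) : EqOn γ γ' (Icc a b) :=
  IsMIntegralCurveOn.eqOn_Icc_of_eq_right D.ξ_smooth hγ hγ' h

end CollarFlowData

namespace CollarFlowData

variable {k : ℕ} {M : Type u} [TopologicalSpace M] [ChartedSpace (EuclideanHalfSpace (k + 1)) M]
  [IsManifold (𝓡∂ (k + 1)) ∞ M] (D : CollarFlowData k M)

/-! ### §8 Chosen boxes and admissible heights -/

/-- A chosen chart box at a point of `N`. [folklore] -/
def boxAt (y : M) (hy : y ∈ D.N) : D.ChartBox y := Classical.choice (D.nonempty_chartBox hy)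

/-- **Admissible heights**: `D.Adm z r` says that some chosen box (centre in `N`) contains `z` in
its domain, has flow time `> r`, and its flow curve through `z` stays in the domain of the box for
all times in `[0, r]` (Lee 2013, proof of Thm. 9.24: the flow time available near a boundary
point). [cite: LeeSmoothManifolds2013, proof of Thm. 9.24] -/
def Adm (z : M) (r : ℝ) : Prop :=
  ∃ (y : M) (hy : y ∈ D.N), z ∈ (D.boxAt y hy).dom ∧ r < (D.boxAt y hy).box.ε ∧
    ∀ s ∈ Icc 0 r, (D.boxAt y hy).curve z s ∈ (D.boxAt y hy).dom

variable {D} in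
/-- Admissibility is downward closed in the height. [folklore] -/
theorem Adm.mono {z : M} {r r' : ℝ} (h : D.Adm z r) (hr : r' ≤ r) : D.Adm z r' := by
  obtain ⟨y, hy, hz, hrε, hmem⟩ := h
  exact ⟨y, hy, hz, lt_of_le_of_lt hr hrε, fun s hs => hmem s ⟨hs.1, hs.2.trans hr⟩⟩

/-- **Locally uniform admissible heights**: near every point of `N` some `r > 0` is admissible
for all nearby points — by joint continuity of the flow of the box at the point on
`dom × [0, ε]` (`Literature.Topology.FourManifolds.CollarFlowData.ChartBox.contMDiffOn_curve`), the flow curves of points near the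
centre stay in the (open) domain for a uniform short time. [cite: LeeSmoothManifolds2013, proof of Thm. 9.24] -/
theorem exists_nhds_adm {z₀ : M} (hz₀ : z₀ ∈ D.N) : ∃ r > 0, ∀ᶠ z in 𝓝 z₀, D.Adm z r := by
  set C := D.boxAt z₀ hz₀ with hC
  have hcont : ContinuousOn (fun p : M × ℝ => C.curve p.1 p.2) (C.dom ×ˢ Icc 0 C.box.ε) :=
    C.contMDiffOn_curve.continuousOn
  have hp₀ : (z₀, (0 : ℝ)) ∈ C.dom ×ˢ Icc 0 C.box.ε := ⟨C.mem_dom, left_mem_Icc.2 C.box.ε_pos.le⟩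
  have hpre : (fun p : M × ℝ => C.curve p.1 p.2) ⁻¹' C.dom ∈ 𝓝[C.dom ×ˢ Icc 0 C.box.ε] (z₀, (0 : ℝ)) := by
    apply (hcont _ hp₀).preimage_mem_nhdsWithin
    apply C.isOpen_dom.mem_nhds
    show C.curve z₀ 0 ∈ C.dom
    rw [C.curve_zero C.mem_dom]
    exact C.mem_dom
  obtain ⟨O, hO, hO₀, hOsub⟩ := mem_nhdsWithin.1 hpre
  obtain ⟨U, hU, V, hV, hUV⟩ := mem_nhds_prod_iff.1 (hO.mem_nhds hO₀)
  obtain ⟨η, hη, hηV⟩ := Metric.mem_nhds_iff.1 hV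
  set r := min (η / 2) (C.box.ε / 2) with hr
  have hrpos : 0 < r := lt_min (by positivity) (by linarith [C.box.ε_pos])
  have hrη : r < η := lt_of_le_of_lt (min_le_left _ _) (by linarith)
  have hrε : r < C.box.ε := lt_of_le_of_lt (min_le_right _ _) (by linarith [C.box.ε_pos])
  refine ⟨r, hrpos, ?_⟩
  have hn : U ∩ C.dom ∈ 𝓝 z₀ := Filter.inter_mem hU (C.isOpen_dom.mem_nhds C.mem_dom)
  filter_upwards [hn] with z hz
  refine ⟨z₀, hz₀, hz.2, hrε, fun s hs => ?_⟩
  have hsV : s ∈ V := hηV (by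
    rw [mem_ball, Real.dist_eq, sub_zero, abs_of_nonneg hs.1]
    exact lt_of_le_of_lt hs.2 hrη)
  have hmem : (z, s) ∈ O ∩ C.dom ×ˢ Icc 0 C.box.ε :=
    ⟨hUV ⟨hz.1, hsV⟩, hz.2, hs.1, hs.2.trans hrε.le⟩
  exact hOsub hmem

/-- The set of positive heights admissible at `z` whenever `z` lies on `{f = 0}` is convex (an
interval: admissibility is downward closed). [folklore] -/
theorem convex_setOf_adm (z : M) : Convex ℝ {r : ℝ | 0 < r ∧ (D.f z = 0 → D.Adm z r)} := by
  rw [convex_iff_ordConnected]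
  refine Set.ordConnected_iff.2 fun a ha b hb _ c hc => ⟨lt_of_lt_of_le ha.1 hc.1, fun h0 => ?_⟩
  exact (hb.2 h0).mono hc.2

/-- **Height functions** (Lee's `δ : ∂M → ℝ₊`, extended to `M`): a smooth positive function on `M`
which is an admissible height at every point of `{f = 0} = ∂M`. [cite: LeeSmoothManifolds2013, Thm. 9.24] -/
structure HeightFn where
  /-- The height function. -/
  α : M → ℝ
  smooth : ContMDiff (𝓡∂ (k + 1)) 𝓘(ℝ, ℝ) ∞ α
  pos : ∀ z, 0 < α z
  adm : ∀ z, D.f z = 0 → D.Adm z (α z)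

/-- **Height functions exist** on Hausdorff σ-compact `M`: Mathlib's
`exists_contMDiffMap_forall_mem_convex_of_local_const` (smooth partitions of unity) for the convex
sets `{r > 0 | f z = 0 → Adm z r}`, locally constant choices being `exists_nhds_adm` near `{f = 0}`
and `1` on the open set `{f ≠ 0}`. [cite: LeeSmoothManifolds2013, Thm. 9.24] -/
theorem nonempty_heightFn [T2Space M] [SigmaCompactSpace M] : Nonempty D.HeightFn := by
  have hloc : ∀ z₀ : M, ∃ c : ℝ, ∀ᶠ z in 𝓝 z₀, c ∈ {r : ℝ | 0 < r ∧ (D.f z = 0 → D.Adm z r)} := by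
    intro z₀
    by_cases h0 : D.f z₀ = 0
    · have hz₀ : z₀ ∈ D.N := D.boundary_subset_N ((D.f_eq_zero_iff z₀).1 h0)
      obtain ⟨r, hr, hev⟩ := D.exists_nhds_adm hz₀
      exact ⟨r, hev.mono fun z hz => ⟨hr, fun _ => hz⟩⟩
    · refine ⟨1, ?_⟩
      have hne : {z | D.f z ≠ 0} ∈ 𝓝 z₀ :=
        (isOpen_ne_fun D.f_smooth.continuous continuous_const).mem_nhds h0
      filter_upwards [hne] with z hz
      exact ⟨one_pos, fun h => absurd h hz⟩
  obtain ⟨g, hg⟩ := exists_contMDiffMap_forall_mem_convex_of_local_const (𝓡∂ (k + 1)) (n := ⊤)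
    (t := fun z => {r : ℝ | 0 < r ∧ (D.f z = 0 → D.Adm z r)}) (fun z => D.convex_setOf_adm z) hloc
  exact ⟨⟨g, g.contMDiff, fun z => (hg z).1, fun z hz => (hg z).2 hz⟩⟩

namespace HeightFn

variable {D} (H : D.HeightFn)

/-- The centre of the box witnessing admissibility of `α z₀` at a point `z₀` of `{f = 0}`.
[folklore] -/
def centre (z₀ : M) (h0 : D.f z₀ = 0) : M := Classical.choose (H.adm z₀ h0)

/-- The centre lies in `N`. [folklore] -/
theorem centre_mem (z₀ : M) (h0 : D.f z₀ = 0) : H.centre z₀ h0 ∈ D.N :=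
  (Classical.choose_spec (H.adm z₀ h0)).fst

/-- **The box at a boundary point**: the chosen box at the centre witnessing admissibility.
[folklore] -/
abbrev bbox (z₀ : M) (h0 : D.f z₀ = 0) : D.ChartBox (H.centre z₀ h0) :=
  D.boxAt (H.centre z₀ h0) (H.centre_mem z₀ h0)

/-- The admissibility properties of the box at a boundary point: the point lies in its domain,
`α z₀` is below its flow time, and the flow curve of `z₀` stays in the domain during `[0, α z₀]`.
[folklore] -/
theorem bbox_spec (z₀ : M) (h0 : D.f z₀ = 0) :
    z₀ ∈ (H.bbox z₀ h0).dom ∧ H.α z₀ < (H.bbox z₀ h0).box.ε ∧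
      ∀ s ∈ Icc 0 (H.α z₀), (H.bbox z₀ h0).curve z₀ s ∈ (H.bbox z₀ h0).dom :=
  (Classical.choose_spec (H.adm z₀ h0)).snd

end HeightFn

/-! ### §9 The tube and the retraction to the boundary -/

/-- **The tube**: the union over all chosen boxes of `dom ∩ {f < ε}`, the region from which the
backward flow reaches the boundary inside one box. [folklore] -/
def tube : Set M := ⋃ (y : M) (hy : y ∈ D.N), (D.boxAt y hy).dom ∩ {z | D.f z < (D.boxAt y hy).box.ε}

/-- The tube is open. [folklore] -/
theorem isOpen_tube : IsOpen D.tube :=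
  isOpen_iUnion fun y => isOpen_iUnion fun hy =>
    (D.boxAt y hy).isOpen_dom.inter (isOpen_lt D.f_smooth.continuous continuous_const)

/-- Membership in the tube. [folklore] -/
theorem mem_tube_iff {z : M} : z ∈ D.tube ↔
    ∃ (y : M) (hy : y ∈ D.N), z ∈ (D.boxAt y hy).dom ∧ D.f z < (D.boxAt y hy).box.ε := by
  simp only [tube, mem_iUnion, mem_inter_iff, mem_setOf_eq]

/-- Points of `dom ∩ {f < ε}` of a chosen box lie in the tube. [folklore] -/
theorem mem_tube {y : M} (hy : y ∈ D.N) {z : M} (hz : z ∈ (D.boxAt y hy).dom)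
    (hfz : D.f z < (D.boxAt y hy).box.ε) : z ∈ D.tube :=
  D.mem_tube_iff.2 ⟨y, hy, hz, hfz⟩

open scoped Classical in
/-- **The retraction to the boundary**: `ret z = curve z (-f z)`, the backward flow of `z` down to
`{f = 0}` in some chosen box containing `z` with `f z < ε` (junk `z` off the tube).  Milnor's
`ψ_y(0)`. [cite: MilnorHCobordism1965, proof of Thm. 3.4] -/
def ret (z : M) : M :=
  if h : ∃ (y : M) (hy : y ∈ D.N), z ∈ (D.boxAt y hy).dom ∧ D.f z < (D.boxAt y hy).box.ε then
    (D.boxAt h.choose h.choose_spec.fst).curve z (-D.f z)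
  else z

variable [T2Space M]

/-- **Box independence of the retraction**: in *any* chosen box containing `z` with `f z < ε`,
`ret z` is the backward flow of that box (backward uniqueness of integral curves on `[-f z, 0]`).
[folklore] -/
theorem ret_eq {y : M} (hy : y ∈ D.N) {z : M} (hz : z ∈ (D.boxAt y hy).dom)
    (hfz : D.f z < (D.boxAt y hy).box.ε) : D.ret z = (D.boxAt y hy).curve z (-D.f z) := by
  classical
  have h : ∃ (y : M) (hy : y ∈ D.N), z ∈ (D.boxAt y hy).dom ∧ D.f z < (D.boxAt y hy).box.ε :=
    ⟨y, hy, hz, hfz⟩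
  unfold ret
  rw [dif_pos h]
  have hy' : h.choose ∈ D.N := h.choose_spec.fst
  obtain ⟨hz', hfz'⟩ := h.choose_spec.snd
  have hf0 : 0 ≤ D.f z := D.f_nonneg z
  have h1 : IsMIntegralCurveOn ((D.boxAt h.choose hy').curve z) D.ξ (Icc (-D.f z) 0) :=
    ((D.boxAt h.choose hy').isMIntegralCurveOn_curve hz' hfz'.le).mono
      (Icc_subset_Icc le_rfl (D.boxAt h.choose hy').box.ε_pos.le)
  have h2 : IsMIntegralCurveOn ((D.boxAt y hy).curve z) D.ξ (Icc (-D.f z) 0) :=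
    ((D.boxAt y hy).isMIntegralCurveOn_curve hz hfz.le).mono
      (Icc_subset_Icc le_rfl (D.boxAt y hy).box.ε_pos.le)
  have h0 : (D.boxAt h.choose hy').curve z 0 = (D.boxAt y hy).curve z 0 := by
    rw [(D.boxAt h.choose hy').curve_zero hz', (D.boxAt y hy).curve_zero hz]
  exact D.eqOn_of_eq_right h1 h2 h0 ⟨le_rfl, by linarith⟩

/-- The retraction lands on `{f = 0}`. [folklore] -/
theorem f_ret {z : M} (hz : z ∈ D.tube) : D.f (D.ret z) = 0 := by
  obtain ⟨y, hy, hzd, hfz⟩ := D.mem_tube_iff.1 hz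
  rw [D.ret_eq hy hzd hfz, (D.boxAt y hy).f_curve hzd hfz.le ⟨le_rfl, by
    linarith [D.f_nonneg z, (D.boxAt y hy).box.ε_pos]⟩]
  ring

/-- The retraction lands on the boundary. [folklore] -/
theorem ret_mem_boundary {z : M} (hz : z ∈ D.tube) : D.ret z ∈ (𝓡∂ (k + 1)).boundary M :=
  (D.f_eq_zero_iff _).1 (D.f_ret hz)

/-- **The retraction is smooth on the tube** (locally it is the smooth retraction of one box,
`Literature.Topology.FourManifolds.CollarFlowData.ChartBox.contMDiffOn_curve_neg`). [cite: MilnorHCobordism1965, proof of Thm. 3.4] -/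
theorem contMDiffOn_ret : ContMDiffOn (𝓡∂ (k + 1)) (𝓡∂ (k + 1)) ∞ D.ret D.tube := by
  apply contMDiffOn_of_locally_contMDiffOn
  intro z₀ hz₀
  obtain ⟨y, hy, hzd, hfz⟩ := D.mem_tube_iff.1 hz₀
  set C := D.boxAt y hy with hC
  refine ⟨C.dom ∩ {z | D.f z < C.box.ε}, C.isOpen_dom.inter
    (isOpen_lt D.f_smooth.continuous continuous_const), ⟨hzd, hfz⟩, ?_⟩
  refine (C.contMDiffOn_curve_neg.mono inter_subset_right).congr fun z hz => ?_
  exact D.ret_eq hy hz.2.1 hz.2.2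

/-- **Retracting a flowed-out boundary point recovers it**: if `f z₀ = 0`, `z₀ ∈ dom C`,
`s ∈ [0, ε_C)` and `curve z₀ s ∈ dom C`, then `ret (curve z₀ s) = z₀` (backward uniqueness on
`[-s, 0]` for `curve (curve z₀ s)` and `t ↦ curve z₀ (t + s)`). Milnor's
`h⁻¹(h(y₀, s)) = (y₀, s)`. [cite: MilnorHCobordism1965, proof of Thm. 3.4] -/
theorem ret_curve {y : M} (hy : y ∈ D.N) {z₀ : M} (h0 : D.f z₀ = 0) (hz₀ : z₀ ∈ (D.boxAt y hy).dom)
    {s : ℝ} (hs : s ∈ Ico 0 (D.boxAt y hy).box.ε)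
    (hmem : (D.boxAt y hy).curve z₀ s ∈ (D.boxAt y hy).dom) :
    D.ret ((D.boxAt y hy).curve z₀ s) = z₀ := by
  set C := D.boxAt y hy with hC
  set w := C.curve z₀ s with hw
  have hz₀ε : D.f z₀ ≤ C.box.ε := by rw [h0]; exact C.box.ε_pos.le
  have hfw : D.f w = s := by
    rw [hw, C.f_curve hz₀ hz₀ε ⟨by rw [h0, neg_zero]; exact hs.1, hs.2.le⟩, h0, zero_add]
  have hfwε : D.f w < C.box.ε := by rw [hfw]; exact hs.2
  rw [D.ret_eq hy hmem hfwε, hfw]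
  -- the two curves on `[-s, 0]`
  have h1 : IsMIntegralCurveOn (C.curve w) D.ξ (Icc (-s) 0) := by
    have h := C.isMIntegralCurveOn_curve hmem hfwε.le
    rw [hfw] at h
    exact h.mono (Icc_subset_Icc le_rfl C.box.ε_pos.le)
  have h2 : IsMIntegralCurveOn (C.curve z₀ ∘ (· + s)) D.ξ (Icc (-s) 0) := by
    refine ((C.isMIntegralCurveOn_curve hz₀ hz₀ε).comp_add s).mono fun t ht => ?_
    show t + s ∈ Icc (-D.f z₀) C.box.ε
    rw [h0, neg_zero]
    constructor <;> linarith [ht.1, ht.2, hs.2]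
  have h0' : C.curve w 0 = (C.curve z₀ ∘ (· + s)) 0 := by
    rw [C.curve_zero hmem]
    show w = C.curve z₀ (0 + s)
    rw [zero_add]
  have h := D.eqOn_of_eq_right h1 h2 h0' (left_mem_Icc.2 (by linarith [hs.1]))
  rw [h]
  show C.curve z₀ (-s + s) = z₀
  rw [neg_add_cancel, C.curve_zero hz₀]

/-- **Flowing out from the retraction recovers the point**: for `z` in the tube and any chosen box
`C` containing `ret z` with `f z ≤ ε_C`, `curve (ret z) (f z) = z` (forward uniqueness on
`[0, f z]` for `curve (ret z)` and `t ↦ curve' z (t - f z)`, `curve'` the box defining `ret z`).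
Milnor's `h(h⁻¹(y)) = y`. [cite: MilnorHCobordism1965, proof of Thm. 3.4] -/
theorem curve_ret {z : M} (hz : z ∈ D.tube) {y : M} (hy : y ∈ D.N)
    (hw : D.ret z ∈ (D.boxAt y hy).dom) (hfz : D.f z ≤ (D.boxAt y hy).box.ε) :
    (D.boxAt y hy).curve (D.ret z) (D.f z) = z := by
  obtain ⟨y', hy', hzd', hfz'⟩ := D.mem_tube_iff.1 hz
  set C := D.boxAt y hy with hC
  set C' := D.boxAt y' hy' with hC'
  set w := D.ret z with hwdef
  have hfw : D.f w = 0 := D.f_ret hz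
  have hf0 : 0 ≤ D.f z := D.f_nonneg z
  have hwε : D.f w ≤ C.box.ε := by rw [hfw]; exact C.box.ε_pos.le
  -- the two curves on `[0, f z]`
  have h1 : IsMIntegralCurveOn (C.curve w) D.ξ (Icc 0 (D.f z)) := by
    have h := C.isMIntegralCurveOn_curve hw hwε
    rw [hfw, neg_zero] at h
    exact h.mono (Icc_subset_Icc le_rfl hfz)
  have h2 : IsMIntegralCurveOn (C'.curve z ∘ (· + -D.f z)) D.ξ (Icc 0 (D.f z)) := by
    refine ((C'.isMIntegralCurveOn_curve hzd' hfz'.le).comp_add (-D.f z)).mono fun t ht => ?_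
    show t + -D.f z ∈ Icc (-D.f z) C'.box.ε
    constructor <;> linarith [ht.1, ht.2, C'.box.ε_pos]
  have h0 : C.curve w 0 = (C'.curve z ∘ (· + -D.f z)) 0 := by
    rw [C.curve_zero hw]
    show w = C'.curve z (0 + -D.f z)
    rw [zero_add, hwdef]
    exact D.ret_eq hy' hzd' hfz'
  have h := D.eqOn_of_eq_left h1 h2 h0 (right_mem_Icc.2 hf0)
  rw [h]
  show C'.curve z (D.f z + -D.f z) = z
  rw [add_neg_cancel, C'.curve_zero hzd']

end CollarFlowData

/-! ### §10 The open collar of a boundary datum -/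

section OpenCollar

variable {n : ℕ} {M : Type u} [TopologicalSpace M] [ChartedSpace (EuclideanHalfSpace (n + 2)) M]
  [IsManifold (𝓡∂ (n + 2)) ∞ M] {D : CollarFlowData (n + 1) M} (H : D.HeightFn)
  (b : BoundaryData (𝓡∂ (n + 2)) M (𝓡 (n + 1)))

namespace CollarFlowData.HeightFn

/-- **The open collar map** `toFun x t = curve (incl x) (t α(incl x) / 2)`: flow out from the
boundary point `incl x` in the box chosen there, for the rescaled time `t α / 2` (`t ∈ [0, 2)`),
Lee's `(x, t) ↦ θ(x, t δ(x))`. [cite: LeeSmoothManifolds2013, proof of Thm. 9.25] -/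
def collarFun (x : b.carrier) (t : ℝ) : M :=
  (H.bbox (b.incl x) (D.f_incl b x)).curve (b.incl x) (t * (H.α (b.incl x) / 2))

/-- The rescaled time `t α / 2` lies in `[0, α]`, hence in `[-f (incl x), ε]`, for `t ∈ [0, 2)`.
[folklore] -/
theorem time_mem (x : b.carrier) {t : ℝ} (ht : t ∈ Ico 0 2) :
    t * (H.α (b.incl x) / 2) ∈ Icc 0 (H.α (b.incl x)) ∧
      t * (H.α (b.incl x) / 2) < H.α (b.incl x) := by
  have hα := H.pos (b.incl x)
  refine ⟨⟨by nlinarith [ht.1], by nlinarith [ht.2]⟩, by nlinarith [ht.2]⟩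

/-- **Level identity along the open collar**: `f (toFun x t) = t α(incl x) / 2`. [folklore] -/
theorem f_collarFun (x : b.carrier) {t : ℝ} (ht : t ∈ Ico 0 2) :
    D.f (H.collarFun b x t) = t * (H.α (b.incl x) / 2) := by
  obtain ⟨hdom, hαε, -⟩ := H.bbox_spec (b.incl x) (D.f_incl b x)
  obtain ⟨hτ, hτα⟩ := H.time_mem b x ht
  have h := (H.bbox (b.incl x) (D.f_incl b x)).f_curve hdom
    (by rw [D.f_incl b x]; exact (H.bbox (b.incl x) (D.f_incl b x)).box.ε_pos.le)
    (t := t * (H.α (b.incl x) / 2))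
    ⟨by rw [D.f_incl b x, neg_zero]; exact hτ.1, by linarith [hτ.2]⟩
  rw [D.f_incl b x, zero_add] at h
  exact h

/-- The open collar stays in the domain of the box chosen at the starting point (this is what
admissibility of `α` provides). [folklore] -/
theorem collarFun_mem_dom (x : b.carrier) {t : ℝ} (ht : t ∈ Ico 0 2) :
    H.collarFun b x t ∈ (H.bbox (b.incl x) (D.f_incl b x)).dom :=
  (H.bbox_spec (b.incl x) (D.f_incl b x)).2.2 _ (H.time_mem b x ht).1

/-- The open collar lies in the tube. [folklore] -/
theorem collarFun_mem_tube (x : b.carrier) {t : ℝ} (ht : t ∈ Ico 0 2) : H.collarFun b x t ∈ D.tube := by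
  refine D.mem_tube (H.centre_mem _ _) (H.collarFun_mem_dom b x ht) ?_
  rw [H.f_collarFun b x ht]
  exact lt_trans (H.time_mem b x ht).2 (H.bbox_spec (b.incl x) (D.f_incl b x)).2.1

variable [T2Space M]

/-- **Retracting the open collar recovers the starting point**: `ret (toFun x t) = incl x`.
[cite: MilnorHCobordism1965, proof of Thm. 3.4] -/
theorem ret_collarFun (x : b.carrier) {t : ℝ} (ht : t ∈ Ico 0 2) : D.ret (H.collarFun b x t) = b.incl x := by
  obtain ⟨hdom, hαε, -⟩ := H.bbox_spec (b.incl x) (D.f_incl b x)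
  obtain ⟨hτ, hτα⟩ := H.time_mem b x ht
  exact D.ret_curve (H.centre_mem _ _) (D.f_incl b x) hdom ⟨hτ.1, lt_trans hτα hαε⟩
    (H.collarFun_mem_dom b x ht)

/-- **Box independence of the open collar**: in any chosen box containing `incl x` with flow time
`> α (incl x)`, `toFun x t` is the flow curve of that box (forward uniqueness on `[0, t α / 2]`).
[folklore] -/
theorem collarFun_eq_curve {x : b.carrier} {y : M} (hy : y ∈ D.N) (hx : b.incl x ∈ (D.boxAt y hy).dom)
    (hα : H.α (b.incl x) < (D.boxAt y hy).box.ε) {t : ℝ} (ht : t ∈ Ico 0 2) :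
    H.collarFun b x t = (D.boxAt y hy).curve (b.incl x) (t * (H.α (b.incl x) / 2)) := by
  obtain ⟨hdom, hαε, -⟩ := H.bbox_spec (b.incl x) (D.f_incl b x)
  obtain ⟨hτ, hτα⟩ := H.time_mem b x ht
  set C := H.bbox (b.incl x) (D.f_incl b x) with hC
  set C' := D.boxAt y hy with hC'
  set τ := t * (H.α (b.incl x) / 2) with hτdef
  have h0C : D.f (b.incl x) ≤ C.box.ε := by rw [D.f_incl b x]; exact C.box.ε_pos.le
  have h0C' : D.f (b.incl x) ≤ C'.box.ε := by rw [D.f_incl b x]; exact C'.box.ε_pos.le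
  have h1 : IsMIntegralCurveOn (C.curve (b.incl x)) D.ξ (Icc 0 τ) :=
    (C.isMIntegralCurveOn_curve hdom h0C).mono
      (Icc_subset_Icc (by rw [D.f_incl b x, neg_zero]) (by linarith))
  have h2 : IsMIntegralCurveOn (C'.curve (b.incl x)) D.ξ (Icc 0 τ) :=
    (C'.isMIntegralCurveOn_curve hx h0C').mono
      (Icc_subset_Icc (by rw [D.f_incl b x, neg_zero]) (by linarith))
  have h0 : C.curve (b.incl x) 0 = C'.curve (b.incl x) 0 := by
    rw [C.curve_zero hdom, C'.curve_zero hx]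
  exact D.eqOn_of_eq_left h1 h2 h0 (right_mem_Icc.2 hτ.1)

variable [Nonempty b.carrier]

/-- **The open collar data of the flow-out with position-dependent height**
(`Literature.Topology.FourManifolds.BoundaryData.OpenCollarData`, `CollarCriterion.lean`): `toFun x t = curve (incl x) (t α / 2)`
on `∂M × [0, 2)`, with inverse `z ↦ (incl⁻¹ (ret z), 2 f z / α (ret z))` on the open region
`{z ∈ tube | f z < α (ret z)}` — Milnor's `h(y₀, s) = ψ_{y₀}(s)`, `h⁻¹(y) = (ψ_y(0), f(y))`, with
Lee's rescaling by `δ = α|∂M`. [cite: LeeSmoothManifolds2013, Thm. 9.25] -/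
def openCollarData : b.OpenCollarData where
  toFun := H.collarFun b
  proj z := b.inclInv (D.ret z)
  height z := D.f z * (2 * (H.α (D.ret z))⁻¹)
  top := 2
  region := {z | z ∈ D.tube ∧ D.f z < H.α (D.ret z)}
  one_lt_top := one_lt_two
  isOpen_region := by
    have hcont : ContinuousOn (fun z => H.α (D.ret z) - D.f z) D.tube :=
      (H.smooth.continuous.comp_continuousOn D.contMDiffOn_ret.continuousOn).sub
        D.f_smooth.continuous.continuousOn
    have h := hcont.isOpen_inter_preimage (t := Ioi 0) D.isOpen_tube isOpen_Ioi
    have heq : {z | z ∈ D.tube ∧ D.f z < H.α (D.ret z)} =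
        D.tube ∩ (fun z => H.α (D.ret z) - D.f z) ⁻¹' Ioi 0 := by
      ext z
      simp only [mem_setOf_eq, mem_inter_iff, mem_preimage, mem_Ioi, sub_pos]
    rw [heq]
    exact h
  apply_zero x := by
    show (H.bbox (b.incl x) (D.f_incl b x)).curve (b.incl x) (0 * (H.α (b.incl x) / 2)) = b.incl x
    rw [zero_mul]
    exact (H.bbox (b.incl x) (D.f_incl b x)).curve_zero (H.bbox_spec (b.incl x) (D.f_incl b x)).1
  mem_region x t ht := by
    refine ⟨H.collarFun_mem_tube b x ht, ?_⟩
    show D.f (H.collarFun b x t) < H.α (D.ret (H.collarFun b x t))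
    rw [H.f_collarFun b x ht, H.ret_collarFun b x ht]
    exact (H.time_mem b x ht).2
  proj_apply x t ht := by
    show b.inclInv (D.ret (H.collarFun b x t)) = x
    rw [H.ret_collarFun b x ht, b.inclInv_incl]
  height_apply x t ht := by
    have hα := (H.pos (b.incl x)).ne'
    show D.f (H.collarFun b x t) * (2 * (H.α (D.ret (H.collarFun b x t)))⁻¹) = t
    rw [H.f_collarFun b x ht, H.ret_collarFun b x ht]
    field_simp
  height_mem z hz := by
    obtain ⟨hzW, hzα⟩ := hz
    have hα := H.pos (D.ret z)
    refine ⟨mul_nonneg (D.f_nonneg z) (by positivity), ?_⟩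
    have h1 : D.f z * (2 * (H.α (D.ret z))⁻¹) = 2 * (D.f z / H.α (D.ret z)) := by ring
    rw [h1]
    have h2 : D.f z / H.α (D.ret z) < 1 := (div_lt_one hα).2 hzα
    linarith
  apply_proj_height z hz := by
    obtain ⟨hzW, hzα⟩ := hz
    have key : ∀ (z₀ : M) (h0 : D.f z₀ = 0), z₀ = D.ret z →
        (H.bbox z₀ h0).curve z₀ (D.f z * (2 * (H.α (D.ret z))⁻¹) * (H.α z₀ / 2)) = z := by
      intro z₀ h0 hz₀
      subst hz₀
      have hα := (H.pos (D.ret z)).ne'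
      have ht : D.f z * (2 * (H.α (D.ret z))⁻¹) * (H.α (D.ret z) / 2) = D.f z := by
        field_simp
      rw [ht]
      obtain ⟨hdom, hαε, -⟩ := H.bbox_spec (D.ret z) h0
      exact D.curve_ret hzW (H.centre_mem _ _) hdom (le_of_lt (lt_trans hzα hαε))
    exact key (b.incl (b.inclInv (D.ret z))) (D.f_incl b _) (b.incl_inclInv (D.ret_mem_boundary hzW))
  contMDiffOn_toFun := by
    apply contMDiffOn_of_locally_contMDiffOn
    rintro ⟨x₀, t₀⟩ ⟨-, ht₀⟩
    obtain ⟨hdom₀, hαε₀, -⟩ := H.bbox_spec (b.incl x₀) (D.f_incl b x₀)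
    set y := H.centre (b.incl x₀) (D.f_incl b x₀) with hydef
    have hy : y ∈ D.N := H.centre_mem _ _
    set C := D.boxAt y hy with hC
    set U : Set b.carrier := {x | b.incl x ∈ C.dom ∧ H.α (b.incl x) < C.box.ε} with hU
    have hUo : IsOpen U := by
      refine (C.isOpen_dom.preimage b.continuous_incl).inter ?_
      exact isOpen_lt (H.smooth.continuous.comp b.continuous_incl) continuous_const
    refine ⟨U ×ˢ univ, hUo.prod isOpen_univ, ⟨⟨hdom₀, hαε₀⟩, mem_univ _⟩, ?_⟩
    -- on this piece `toFun` is the flow curve of the fixed box `C`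
    have hαs : ContMDiff (𝓡 (n + 1)) 𝓘(ℝ, ℝ) ∞ (fun x : b.carrier => H.α (b.incl x)) :=
      H.smooth.comp b.isSmoothEmbedding.contMDiff
    have htime : ContDiff ℝ ∞ (fun q : ℝ × ℝ => q.2 * (q.1 / 2)) :=
      contDiff_snd.mul (contDiff_fst.div_const 2)
    have hinner : ContMDiffOn ((𝓡 (n + 1)).prod 𝓘(ℝ, ℝ)) ((𝓡∂ (n + 2)).prod 𝓘(ℝ, ℝ)) ∞
        (fun p : b.carrier × ℝ => (b.incl p.1, p.2 * (H.α (b.incl p.1) / 2)))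
        (univ : Set (b.carrier × ℝ)) := by
      refine ContMDiffOn.prodMk ?_ ?_
      · exact b.isSmoothEmbedding.contMDiff.comp_contMDiffOn contMDiffOn_fst
      · exact htime.contMDiff.comp_contMDiffOn
          ((hαs.comp_contMDiffOn contMDiffOn_fst).prodMk_space contMDiffOn_snd)
    have hinner' : ContMDiffOn ((𝓡 (n + 1)).prod 𝓘(ℝ, ℝ)) ((𝓡∂ (n + 2)).prod 𝓘(ℝ, ℝ)) ∞
        (fun p : b.carrier × ℝ => (b.incl p.1, p.2 * (H.α (b.incl p.1) / 2)))
        ((univ ×ˢ Ico (0 : ℝ) 2) ∩ U ×ˢ univ) := hinner.mono (subset_univ _)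
    have hcomp := C.contMDiffOn_curve.comp hinner' fun p hp => by
      refine ⟨hp.2.1.1, ?_⟩
      obtain ⟨hτ, hτα⟩ := H.time_mem b p.1 hp.1.2
      exact ⟨hτ.1, le_of_lt (lt_trans hτα hp.2.1.2)⟩
    refine hcomp.congr fun p hp => ?_
    exact H.collarFun_eq_curve b hy hp.2.1.1 hp.2.1.2 hp.1.2
  contMDiffOn_proj := by
    refine b.contMDiffOn_inclInv.comp (D.contMDiffOn_ret.mono fun z hz => hz.1) fun z hz => ?_
    rw [b.range_incl]
    exact D.ret_mem_boundary hz.1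
  contMDiffOn_height := by
    have hαret : ContMDiffOn (𝓡∂ (n + 2)) 𝓘(ℝ, ℝ) ∞ (fun z => H.α (D.ret z)) D.tube :=
      H.smooth.comp_contMDiffOn D.contMDiffOn_ret
    have hinv : ContMDiffOn (𝓡∂ (n + 2)) 𝓘(ℝ, ℝ) ∞ (fun z => (H.α (D.ret z))⁻¹) D.tube :=
      hαret.inv₀ fun z _ => (H.pos _).ne'
    have h2 : ContMDiffOn (𝓡∂ (n + 2)) 𝓘(ℝ, ℝ) ∞ (fun z => (2 : ℝ) * (H.α (D.ret z))⁻¹) D.tube :=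
      contMDiffOn_const.mul hinv
    exact (D.f_smooth.contMDiffOn.mul h2).mono fun z hz => hz.1

end CollarFlowData.HeightFn

end OpenCollar

section CollarTheorem

variable {n : ℕ} {M : Type u} [TopologicalSpace M] [ChartedSpace (EuclideanHalfSpace (n + 2)) M]
  [IsManifold (𝓡∂ (n + 2)) ∞ M] [T2Space M]

/-- **The boundary of a manifold with boundary carrying collar flow data and a height function
admits a collar** (`CollarCriterion.lean`, `OpenCollarData.toCollar`), in dimension `n + 2 ≥ 2`,
for a nonempty boundary. [cite: LeeSmoothManifolds2013, Thm. 9.25] -/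
theorem CollarFlowData.HeightFn.nonempty_collar {D : CollarFlowData (n + 1) M} (H : D.HeightFn)
    (b : BoundaryData (𝓡∂ (n + 2)) M (𝓡 (n + 1))) [Nonempty b.carrier] : Nonempty b.Collar :=
  (H.openCollarData b).nonempty_collar

/-- **Collar flow data yield collars** (Hausdorff σ-compact `M` of dimension `n + 2 ≥ 2`, any
boundary datum): a height function exists (`nonempty_heightFn`) and gives the open collar data;
an empty boundary has the vacuous collar. [cite: LeeSmoothManifolds2013, Thm. 9.25] -/
theorem CollarFlowData.nonempty_collar [SigmaCompactSpace M] (D : CollarFlowData (n + 1) M)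
    (b : BoundaryData (𝓡∂ (n + 2)) M (𝓡 (n + 1))) : Nonempty b.Collar := by
  rcases isEmpty_or_nonempty b.carrier with h | h
  · exact ⟨b.collarOfIsEmpty⟩
  · obtain ⟨H⟩ := D.nonempty_heightFn
    exact H.nonempty_collar b

end CollarTheorem

/-! ### §11 The collar neighbourhood theorem -/

/-- **Collar neighbourhood theorem** — discharge of the named fact
`Literature.Topology.FourManifolds.BoundaryData.nonempty_collar` (`Gluing.lean`): the boundary of every smooth `(n+2)`-manifold
with boundary `M` (Hausdorff, second countable, model `𝓡∂ (n + 2)`), compact or not, admits a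
collar `∂M × [0, 1] ↪ M` for every boundary datum (Hirsch, *Differential Topology* (1976),
Ch. 4 §6, Thm. 6.1, p. 113: "`∂M` has a collar"; the proof by differential equations is
Ch. 6 §2, Thm. 2.1, p. 152: an inward vector field `X` on a neighbourhood of `∂M` from charts and a
partition of unity, its flow `η` defined on a neighbourhood `W ⊆ ∂M × [0, ∞)` of `∂M × 0`, an
embedding `h : ∂M × [0, ∞) → W` fixing `∂M × 0`, and `F = η ∘ h` — here `X = ξ`, `W` is cut out
by the height function `α` and `h (x, t) = (x, t α(x) / 2)`; Lee (2013), Thm. 9.25; Milnor (1965),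
proof of Thm. 3.4 for the normalisation `ξ(f) = 1` giving the explicit inverse).  Proof: `M` is
σ-compact; collar flow data exist (`nonempty_collarFlowData`); flow out with a position-dependent
height (`CollarFlowData.nonempty_collar`). [cite: Hirsch1976, Ch. 4 §6 Thm. 6.1 (p. 113) and Ch. 6 §2 Thm. 2.1 (p. 152)] -/
theorem BoundaryData.nonempty_collar_holds : BoundaryData.nonempty_collar.{u} := by
  intro n M _ _ _ _ _ b
  haveI : SigmaCompactSpace M := sigmaCompactSpace_of_chartedSpace_euclideanHalfSpace (n + 1) M
  obtain ⟨D⟩ := nonempty_collarFlowData (k := n + 1) (M := M)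
  exact D.nonempty_collar b

end Literature.Topology.FourManifolds
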